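import Summits.BirchSwinnertonDyer.BirchSwinnertonDyer.Theorems.CorpuzLei2025_signedMainConjecture_transfer_OPEN
import Summits.BirchSwinnertonDyer.BirchSwinnertonDyer.Theorems.SignedLowerHalvesSprungLowerHalfAtThreeChromaticReduction
import Summits.BirchSwinnertonDyer.Rank1Residual.Supersingular.SharpFlatConverseReal
import Summits.BirchSwinnertonDyer.Rank1Residual.Supersingular.SharpFlatNonvanishing
import Summits.BirchSwinnertonDyer.Rank1Residual.Supersingular.SignedMuVanishing
import Literature.NumberTheory.EllipticCurves.Rank1Residual.Typed.X8
import HarnessLib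

/-!
# Route `SignedLowerHalves`, crux `SprungLowerHalfAtThree` (item stmt-BirchSwinnertonDyer-19003) — the
# «CM-congruence transfer» line ON X8 (`p = 3`, `a_3 = ±3`): ONE explicitly labelled OPEN hypothesis, the
# ♯/♭ version of Corpuz–Lei's supersingular Greenberg–Vatsal transfer (arXiv:2508.09733, 2025, PREPRINT),
# and its consumers on the small-image (3Nn) X8 cells (cell `bsd-ssimc`, seat `bsd-ssimc-k3-c5` gen 3;
# planner question Q14-X8 / D14-3)

HONEST FRAMING: an UNREFEREED preprint enters the tree ONLY as an explicitly labelled OPEN hypothesis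
(`@[conjecture] def … : Prop`, an OBLIGATION of ours, filed under `Theorems/<its own name>.lean`; nothing
asserted; consumers take it as a binder `(hCL : …)`) — the pattern of the sibling binder for item 4,
`…Theorems.CorpuzLei2025_signedMainConjecture_transfer_OPEN` (seat k3-c4), which is typed for
`a_p(W₁) = 0` and therefore does NOT cover X8. Nothing about any curve is asserted; nothing is booked;
crux 5 stays OPEN (it closes only with Modularity as a tree theorem, k3-c5 MEMO-1 R1).

## Q14-X8 (planner D14-3): does the transfer admit `a_3(f) = ±3 ≠ 0 = a_3(g)`? — YES, as printed

Corpuz–Lei [CorpuzLei2025] (text `paper:arxiv-2508.09733`): p. 3 «non-ordinary … `ord_p(a_p),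
ord_p(b_p) > 0`»; `L_p(∗, ♮)` are Sprung's `♯/♭` «without the assumption that `a_p(f) = 0`» (p. 2), rebuilt
from the Büyükboduk–Lei logarithmic matrix (Def. 3.10: `P_f` carries `a_p(f)`). Assumptions (pp. 3–4):
(1) `a_m ≡ b_m (mod ϖ^r)`, `(m, N) = 1` — INCLUDING `m = p`: `±3 ≡ 0 (mod 3)`; (2) `p > k`: `3 > 2`;
(3) coefficients unramified: `ℚ_3`; (4) `L_p(f, ♮, ω⁰) ≠ 0 ≠ L_p(g, ♮, ω⁰)`; (5) `T_f/ϖ ≅ T_g/ϖ`. Where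
`a_p` enters: Thm. 3.13 / Thm. 4.5 use only «`C_{n,f} ≡` anti-diagonal `(mod ϖ)`» (⇐ `ord_p a_p > 0`)
and Lemma 4.4 «`C_{n,f} ≡ C_{n,g} (mod p^r)`» (⇐ `a_p(f) ≡ a_p(g)`); never `a_p(f) = a_p(g)`. Algebraic
side (Thm. 5.9) = Hatley–Lei, AIF 69 (2019) §4.2: (BLZ) «`ord_p a_p(f), ord_p a_p(g) > ⌊(k−2)/(p−1)⌋`»
`= 0` holds, (inv) ⇐ `k ≤ p`; its own example (§7) has `a_5(f) = −10 ≠ 10 = a_5(g)`. Thm. 5.10 needs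
`μ^♮_alg = μ^♮_an = 0` for BOTH forms, but Thms. 5.3/5.9 give `μ(f) = 0 ⟺ μ(g) = 0`: the partner's
`μ = 0` suffices. The SMALL IMAGE of the cells is no obstruction: Prop. 5.8 is the RATIONAL Kato inclusion.
AUDIT POINTS (statement matching; not obstructions): (A-CL♯♭-1) Büyükboduk–Lei/LLZ Wach-basis `♯/♭` ≡
Sprung's Mazur–Tate `♯/♭` (`IsSprungPair`) up to `Λ^×`; (A-CL♯♭-2) `ξ_{0,♮} = 1` in weight `2`
(Büyükboduk–Lei IMRN 2021 Rem. 2.13); (A-CL♯♭-3) cohomological vs lattice period of `f` (`p`-unit ratio at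
an irreducible odd good `p`, Greenberg–Vatsal 2000 Rem. 3.4, as in the sibling binder); (A-CL♯♭-4) (K•)
for the characteristic power series of Sprung's `Sel^♮` (Sprung 2024 Lemmas 5.5–5.9) — the ♯/♭ Selmer
groups are not tree vocabulary, so the conclusion lives on the crux's abstract `SignedDatum`, as in every
X8 file of the tree.

## Declarations

* `CorpuzLei2025_sharpFlatMainConjecture_transfer_OPEN` — the binder (hypothesis on `W₂` = the sibling
  binder's clause verbatim, EVERY sign; conclusion for `W₁` = for every newform, Sprung pair and colour
  with `L^• ≠ 0`: `ξ ∈ Λ` with (K•) and `(ξ) = (L^•)` — Sprung's Main Conj. 7.21 for that colour).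
* `hasUnitContent_kobayashiL_of_signedMuVanishing` — the tree's `μ`-node `SignedMuVanishing W' p` at
  `a_p(W') = 0` IS unit content of Kobayashi's `L^ε` (both signs); unit case = THEOREM
  `signedMuVanishing_of_frobeniusTrace_eq_zero`.
* `sharpFlatMainConjecture_of_cmPartner_of_transfer_OPEN` — **the class theorem on X8**: CM partner
  (`HasCM`, `GoodSS`, `a_p = 0`, `W[p] ≃ W'[p]`, `SignedMuVanishing`) + Pollack–Rubin + period facts +
  the binder ⟹ the conclusion for `W`; NO image hypothesis on `W`.
* `X8.stub_chromaticDivisibility_of_cmPartner_of_transfer_OPEN` — the REGISTERED stub (B) of the BC3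
  skeleton, header VERBATIM, partner data as the one extra hypothesis, at EVERY analytic rank, NO
  (conv₀)/(low₀) input (some colour is non-zero on X8 by Rohrlich: `ClassX8.exists_chromaticL_ne_zero`).
* `X8.bsdp_of_cmPartner_of_transfer_OPEN_of_analyticRank_eq_zero` (+ `X8.missingInputAt_…`) —
  `BSD(E,3)` on CM-partnered X8 pairs of analytic rank `0`: the EQUALITY feeds the tree's
  `bsdp_iff_span_eq_span_chromaticL_of_analyticRank_eq_zero`; no surjectivity, no Wuthrich.

Census (k3-c5 g3, kit j251003, Fisher Hesse-pencil certificates): of the 61 non-surjective (3Nn) X8 cells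
of the window — the only X8 cells no PRE engine reaches (`…SprungLowerHalfAtThreeSmallImage.lean`) — 37
are `3`-congruent to a CM curve `y² = x³ + Ax` (`K = ℚ(i)`; 10 in the unit case, e.g. `46112f1 ↔
y² = x³ − x`), 18 have a NON-rational CM newform partner (`K ∈ {ℚ(√−7), ℚ(√−19), ℚ(√−43), ℚ(√−67),
ℚ(√−163)}`), 6 have `h_K ∈ {2, 3}`. NOT claimed: the binder (PRE); any partner or `μ = 0` for any curve
(per pair: Hesse-pencil certificate + `μ`-certificate); the rank-`1` cell; anything booked.

References: [CorpuzLei2025] Thms 1–3 (= 5.3, 5.9, 5.10), Prop. 5.8, Assumptions 1–5, Def. 3.10, Lemma 4.4;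
[HatleyLei2019] §4.2, §7; [Sprung2012] Main Conj. 7.21, Prop. 6.14; [Sprung2017] Thm. 1.12, Cor. 4.11;
[Sprung2024] Lemmas 5.5–5.9; [PollackRubin2004] Thm. (p. 448); [Kobayashi2003] (3.6); [GreenbergVatsal2000]
Rem. 3.4; [PerrinRiou2003] Conj. 6.1.1; [Fisher2012] Thm. 13.2, §13. Memo: `HOME/bsd-ssimc-k3-c5-MEMO-3.md`.
-/

set_option autoImplicit false
set_option linter.dupNamespace false

noncomputable section

open scoped Classical MatrixGroups ModularForm

open CongruenceSubgroup WeierstrassCurve Literature.NumberTheory.EllipticCurves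
  Literature.NumberTheory.EllipticCurves.ModularForms
  Literature.NumberTheory.EllipticCurves.Kobayashi2003 ZpExtension
  Literature.NumberTheory.EllipticCurves.GreenbergVatsal2000
  Literature.NumberTheory.EllipticCurves.Sprung2017
  Literature.NumberTheory.EllipticCurves.Rank1Residual
  Literature.NumberTheory.EllipticCurves.Rank1Residual.Typed
  Summit.BirchSwinnertonDyer.Rank1Residual.Supersingular
  Summit.BirchSwinnertonDyer.Rank1Residual.X1.MuLambda

namespace Summit.BirchSwinnertonDyer.BirchSwinnertonDyer.Theorems

/-- **OPEN HYPOTHESIS — UNREFEREED PREPRINT (Corpuz–Lei, arXiv:2508.09733, 2025), Theorems 1 + 2 + 3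
composed, ♯/♭ version (first curve NON-ORDINARY with `a_p ≠ 0` allowed, second with `a_p = 0`).** For
globally minimal `W₁, W₂ / ℚ`, an odd prime `p` of good reduction for both with `p ∣ a_p(W₁)` («`ord_p a_p
> 0`», p. 3) and `a_p(W₂) = 0`, and a `Γ_ℚ`-equivariant additive isomorphism `W₁[p] ≃ W₂[p]` (Assumption
5, hence 1 incl. `a_p(W₁) ≡ 0 (mod p)` — all that Lemma 4.4 uses): IF for `W₂` and EVERY sign `ε`
Kobayashi's main conjecture holds WITH UNIT CONTENT (the sibling binder's clause verbatim: every cyclotomic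
datum, the newform `f₂`, the period ratio `ϖ₂`, every Pollack pair, every dual datum of `Sel^ε(W₂/ℚ_∞)`:
`X^ε` torsion, `char X^ε = (g₂)`, `HasUnitContent g₂`, `ι g₂ = ϖ₂ · ι L^ε`), THEN for every newform `f₁`
of `W₁` (any level), every Sprung pair `(L♯, L♭)` of `f₁` for `a_p(W₁)` and every colour `•` with `L^• ≠
0` (Assumption 4) there is `ξ ∈ Λ` with the Euler-characteristic property (K•) of the tree's X8 datum and
`(ξ) = (L^•)` in `Λ`. (Print: Thms 1/2 transfer `μ_an`/`μ_alg`, Thm 3 the signed IMC `char 𝒳^♮(f)^{ω⁰} =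
(L_p(f, ♮, ω⁰))` when all four `μ` vanish, `ξ_{0,♮} = 1` in weight `2`; read through (A-CL♯♭-1…4) of the
module docstring.) Both signs in the hypothesis ⟹ both colours in the conclusion, so no `♮ ↔ ε`
dictionary is asserted. NEVER cite this `Prop` as a theorem; take it as an explicit hypothesis
`(hCL : CorpuzLei2025_sharpFlatMainConjecture_transfer_OPEN)`. Weaker than the print, never stronger.
[claim: CorpuzLei2025, status: under-review] [cite: Sprung2012, Main Conj. 7.21 and Prop. 7.19 (p. 1505)]
[cite: Kobayashi2003, Conjecture (Main Conjecture) (p. 2)] [cite: GreenbergVatsal2000, §3 Remark 3.4]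
[cite: Sprung2024, Lemmas 5.5–5.9 (pp. 40–41)] -/
@[conjecture] def CorpuzLei2025_sharpFlatMainConjecture_transfer_OPEN : Prop :=
  ∀ (W₁ W₂ : WeierstrassCurve ℚ) [W₁.IsElliptic] [W₁.IsGloballyMinimal] [W₂.IsElliptic]
    [W₂.IsGloballyMinimal] (p : ℕ) [Fact p.Prime],
    p ≠ 2 →
    W₁.HasGoodReductionAtPrime p → (p : ℤ) ∣ W₁.frobeniusTrace p →
    W₂.HasGoodReductionAtPrime p → W₂.frobeniusTrace p = 0 →
    (∃ e : geomTorsion W₁ (p : ℤ) ≃+ geomTorsion W₂ (p : ℤ),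
      ∀ (σ : Field.absoluteGaloisGroup ℚ) (P : geomTorsion W₁ (p : ℤ)), e (σ • P) = σ • e P) →
    (∀ (ε : ℤˣ) (κ : ZpExtension ℚ p) (γ : Field.absoluteGaloisGroup ℚ),
        κ.IsCyclotomic → κ.IsTopGenerator γ → IsCyclotomicVariable p γ →
      ∀ [NeZero (W₂.conductorNorm ℤ)] (f₂ : CuspForm (Gamma0 (W₂.conductorNorm ℤ)) 2),
        IsNewformOf W₂ f₂ → ∀ (ϖ₂ : ℚ), (ϖ₂ : ℝ) * W₂.realPeriodRat = plusPeriod f₂ →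
      ∀ (Lplus Lminus : IwasawaAlgebra p), IsPollackPair f₂ p Lplus Lminus →
      ∀ (D₂ : SignedSelmerDualData W₂ κ γ ε), Module.IsTorsion (IwasawaAlgebra p) D₂.X ∧
        ∃ g₂ : IwasawaAlgebra p, D₂.charIdeal = Ideal.span {g₂} ∧ HasUnitContent g₂ ∧
          iwasawaToPowerSeries p g₂ =
            PowerSeries.C (ϖ₂ : ℚ_[p]) * iwasawaToPowerSeries p (kobayashiL ε Lplus Lminus)) →
    ∀ {N : ℕ} [NeZero N] (f₁ : CuspForm (Gamma0 N) 2), IsNewformOf W₁ f₁ →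
    ∀ (Lsharp Lflat : IwasawaAlgebra p), IsSprungPair f₁ p (W₁.frobeniusTrace p) Lsharp Lflat →
    ∀ (c : Chroma), chromaticL c Lsharp Lflat ≠ 0 →
      ∃ ξ : IwasawaAlgebra p, (⟨ξ, 0, 0⟩ : SignedDatum W₁ p).EulerCharacteristic ∧
        Ideal.span ({ξ} : Set (IwasawaAlgebra p)) = Ideal.span {chromaticL c Lsharp Lflat}


section Glue

/-- A non-zero `g ∈ Λ` with `μ(g) = 0` has unit content (copy of
`X11a.MuLambdaSplit.hasUnitContent_of_mu_eq_zero`, kept private here to avoid importing the class-X11a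
certificate files). [cite: GreenbergVatsal2000, p. 2, (2)] -/
private theorem hasUnitContent_of_mu_eq_zero_aux {p : ℕ} [Fact p.Prime] {g : IwasawaAlgebra p}
    (hg : g ≠ 0) (h : mu g = 0) :
    HasUnitContent g := by
  rw [hasUnitContent_iff_not_C_dvd]
  intro hdvd
  have h1 : 1 ≤ mu g := le_mu_of_C_pow_dvd hg (n := 1) (by rwa [pow_one])
  omega

/-- **`SignedMuVanishing W' p` at `a_p(W') = 0` ⟹ unit content of Kobayashi's `L^ε_p(W')` for both
signs.** A Pollack pair `(L⁺, L⁻)` of the newform of `W'` IS a Sprung pair for the trace `0`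
(`isSprungPair_zero_iff`: `L♯ = L⁺`, `L♭ = L⁻`), so the node gives `L^± ≠ 0 ∧ μ(L^±) = 0`, i.e. unit
content; Kobayashi's `L^ε` is one of the two (`kobayashiL`). In the unit case (`ord_p [0]⁺_f = 0`) the node
is the tree THEOREM `signedMuVanishing_of_frobeniusTrace_eq_zero`. [cite: PerrinRiou2003, §6.1 Conjecture 6.1.1]
[cite: Kobayashi2003, (3.6) (p. 7)] [cite: Sprung2017, §3.1 and Cor. 4.4] -/
theorem hasUnitContent_kobayashiL_of_signedMuVanishing (W' : WeierstrassCurve ℚ) [W'.IsElliptic]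
    [W'.IsGloballyMinimal] (p : ℕ) [Fact p.Prime] (hμ : SignedMuVanishing W' p)
    (hap' : W'.frobeniusTrace p = 0) :
    ∀ [NeZero (W'.conductorNorm ℤ)] (f' : CuspForm (Gamma0 (W'.conductorNorm ℤ)) 2),
      IsNewformOf W' f' → ∀ (Lplus Lminus : IwasawaAlgebra p), IsPollackPair f' p Lplus Lminus →
      ∀ ε : ℤˣ, HasUnitContent (kobayashiL ε Lplus Lminus) := by
  intro _ f' hf' Lplus Lminus hL ε
  have hSP : IsSprungPair f' p (W'.frobeniusTrace p) Lplus Lminus := by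
    rw [hap']
    exact (isSprungPair_zero_iff f' p Lplus Lminus).mpr ⟨hL.2.2.1, hL.2.2.2⟩
  have hs := hμ f' hf' Lplus Lminus hSP .sharp; rw [chromaticL_sharp] at hs
  have hf := hμ f' hf' Lplus Lminus hSP .flat; rw [chromaticL_flat] at hf
  by_cases hε : ε = 1
  · simp only [kobayashiL, hε, if_true]
    exact hasUnitContent_of_mu_eq_zero_aux hf.1 hf.2
  · simp only [kobayashiL, hε, if_false]
    exact hasUnitContent_of_mu_eq_zero_aux hs.1 hs.2

end Glue

section Consumers

variable (W W' : WeierstrassCurve ℚ) [W.IsElliptic] [W.IsGloballyMinimal] [W'.IsElliptic]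
  [W'.IsGloballyMinimal] (p : ℕ) [Fact p.Prime]

/-- The sibling binder's `W₂`-clause (Kobayashi's main conjecture WITH UNIT CONTENT, every sign) for a
CM partner: Pollack–Rubin 2004 (`hPR`) gives `char X^ε(W') = (g')` with `ι g' = ϖ'·ι L^ε(W')`; the
period ratio `ϖ'` is a `p`-adic unit at the odd good irreducible prime `p` (`h5`/`h3`), so
`g' = C(u)·L^ε` has unit content iff `L^ε` does (`hμ'`). (This is the body of k3-c4's
`kobayashiMainConjecture_of_cmPartner_of_transfer_OPEN`, factored out.) Nothing asserted beyond the named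
facts. [cite: PollackRubin2004, Theorem (p. 448) = Thm. 7.3] [cite: GreenbergVatsal2000, §3 Remark 3.4]
[cite: Kobayashi2003, Conjecture (Main Conjecture) (p. 2)] -/
theorem kobayashiMainConjecture_unitContent_of_cmPartner
    (hPR : PollackRubin2004.mainTheorem_signedCharIdeal_eq_of_cm)
    (h5 : realPeriodRat_eq_unit_mul_plusPeriod) (h3 : realPeriodRat_eq_unit_mul_plusPeriod_three)
    (hp : p ≠ 2) (hcm' : W'.HasCM) (hss' : GoodSS W' p)
    (hμ' : ∀ [NeZero (W'.conductorNorm ℤ)] (f' : CuspForm (Gamma0 (W'.conductorNorm ℤ)) 2),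
      IsNewformOf W' f' → ∀ (Lplus Lminus : IwasawaAlgebra p), IsPollackPair f' p Lplus Lminus →
      ∀ ε : ℤˣ, HasUnitContent (kobayashiL ε Lplus Lminus)) :
    ∀ (ε : ℤˣ) (κ : ZpExtension ℚ p) (γ : Field.absoluteGaloisGroup ℚ),
        κ.IsCyclotomic → κ.IsTopGenerator γ → IsCyclotomicVariable p γ →
      ∀ [NeZero (W'.conductorNorm ℤ)] (f₂ : CuspForm (Gamma0 (W'.conductorNorm ℤ)) 2),
        IsNewformOf W' f₂ → ∀ (ϖ₂ : ℚ), (ϖ₂ : ℝ) * W'.realPeriodRat = plusPeriod f₂ →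
      ∀ (Lplus Lminus : IwasawaAlgebra p), IsPollackPair f₂ p Lplus Lminus →
      ∀ (D₂ : SignedSelmerDualData W' κ γ ε), Module.IsTorsion (IwasawaAlgebra p) D₂.X ∧
        ∃ g₂ : IwasawaAlgebra p, D₂.charIdeal = Ideal.span {g₂} ∧ HasUnitContent g₂ ∧
          iwasawaToPowerSeries p g₂ =
            PowerSeries.C (ϖ₂ : ℚ_[p]) * iwasawaToPowerSeries p (kobayashiL ε Lplus Lminus) := by
  intro ε κ γ hκ hγ hγ' _ f' hf' ϖ' hϖ' Lplus Lminus hL D'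
  obtain ⟨htor, g, hg, hι⟩ :=
    kobayashiMainConjecture_of_pollackRubin_of_goodSS W' p hPR hcm' hp hss' ε κ γ hκ hγ hγ' f' hf' ϖ'
      hϖ' Lplus Lminus hL D'
  refine ⟨htor, g, hg, ?_, hι⟩
  have hirr' : W'.HasIrreducibleModPGaloisRep p :=
    hasIrreducibleModPGaloisRep_of_dvd_frobeniusTrace W' p hp
      (W'.not_dvd_minimalDiscriminantInt_of_hasGoodReductionAtPrime' p hss'.1) hss'.2
  have hvϖ : padicValRat p ϖ' = 0 :=
    padicValRat_periodRatio_eq_zero h5 h3 W' p hp hss'.1 hirr' f' hf' ϖ' hϖ'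
  have hϖ0 : ϖ' ≠ 0 := by
    intro hz
    rw [hz, Rat.cast_zero, zero_mul] at hϖ'
    exact (IsNewform0.plusPeriod_pos_holds hf'.1 hf'.coeffField_eq_bot).ne' hϖ'.symm
  obtain ⟨u, hu⟩ := exists_units_coe_eq_ratCast hϖ0 hvϖ
  obtain ⟨-, hιu⟩ := span_C_units_mul_eq u (kobayashiL ε Lplus Lminus)
  have hgeq : g = PowerSeries.C (u : ℤ_[p]) * kobayashiL ε Lplus Lminus :=
    iwasawaToPowerSeries_injective p (by rw [hι, hιu, hu])
  rw [hgeq, hasUnitContent_unit_mul_iff ((Units.isUnit u).map PowerSeries.C)]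
  exact hμ' f' hf' Lplus Lminus hL ε

/-- **The CM-congruence transfer on X8 (class theorem of the line, MODULO the OPEN binder).** Let `p`
be an odd prime of good reduction of `E = W` with `p ∣ a_p` — `a_p ≠ 0` ALLOWED (X8: `p = 3`,
`a_3 = ±3`), ANY image — and let `E' = W'` be a CM curve (`W'.HasCM`) with good supersingular reduction
at `p` and `a_p(E') = 0`, congruent to `E` mod `p` (`hiso`: a `Γ_ℚ`-equivariant `E[p] ≃ E'[p]`) whose
signed `μ`-invariants vanish (`hμ : SignedMuVanishing W' p`, the tree's node; a THEOREM in the unit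
case). Granted BY NAME Pollack–Rubin 2004 (`hPR`), the period-unit facts (`h5`, `h3`) and the OPEN
binder (`hCL`, Corpuz–Lei 2025 ♯/♭, PRE): for every newform `f` of `W`, every Sprung pair and every
colour `•` with `L^• ≠ 0`, a characteristic element `ξ` with (K•) and `(ξ) = (L^•)` — Sprung's Main
Conj. 7.21 for that colour in the tree's X8 currency. CONDITIONAL on `hCL`; nothing asserted about any
curve. [claim: CorpuzLei2025, status: under-review] [cite: PollackRubin2004, Theorem (p. 448) = Thm. 7.3]
[cite: Sprung2012, Main Conj. 7.21 (p. 1505)] [cite: PerrinRiou2003, §6.1 Conjecture 6.1.1] -/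
theorem sharpFlatMainConjecture_of_cmPartner_of_transfer_OPEN
    (hCL : CorpuzLei2025_sharpFlatMainConjecture_transfer_OPEN)
    (hPR : PollackRubin2004.mainTheorem_signedCharIdeal_eq_of_cm)
    (h5 : realPeriodRat_eq_unit_mul_plusPeriod) (h3 : realPeriodRat_eq_unit_mul_plusPeriod_three)
    (hp : p ≠ 2) (hgood : W.HasGoodReductionAtPrime p) (hap : (p : ℤ) ∣ W.frobeniusTrace p)
    (hcm' : W'.HasCM) (hss' : GoodSS W' p) (hap' : W'.frobeniusTrace p = 0)
    (hiso : ∃ e : geomTorsion W (p : ℤ) ≃+ geomTorsion W' (p : ℤ),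
      ∀ (σ : Field.absoluteGaloisGroup ℚ) (P : geomTorsion W (p : ℤ)), e (σ • P) = σ • e P)
    (hμ : SignedMuVanishing W' p)
    {N : ℕ} [NeZero N] {f : CuspForm (Gamma0 N) 2} (hf : IsNewformOf W f)
    {Lsharp Lflat : IwasawaAlgebra p} (hSP : IsSprungPair f p (W.frobeniusTrace p) Lsharp Lflat)
    (c : Chroma) (hc : chromaticL c Lsharp Lflat ≠ 0) :
    ∃ ξ : IwasawaAlgebra p, (⟨ξ, 0, 0⟩ : SignedDatum W p).EulerCharacteristic ∧
      Ideal.span ({ξ} : Set (IwasawaAlgebra p)) = Ideal.span {chromaticL c Lsharp Lflat} :=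
  hCL W W' p hp hgood hap hss'.1 hap' hiso
    (kobayashiMainConjecture_unitContent_of_cmPartner W' p hPR h5 h3 hp hcm' hss'
      (hasUnitContent_kobayashiL_of_signedMuVanishing W' p hμ hap'))
    f hf Lsharp Lflat hSP c hc

/-- From `(ξ) = (L)` and a `p`-adic unit `ϖ ∈ ℚ`: `ι ξ = ϖ · ι(L · h)` for a UNIT `h ∈ Λ` (bookkeeping:
`ξ = v·L`, `v ∈ Λ^×`, `ϖ = u ∈ ℤ_p^×`, `h = C(u)⁻¹ v`). [folklore] -/
theorem exists_isUnit_eq_C_mul_of_span_eq {ξ L : IwasawaAlgebra p}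
    (hspan : Ideal.span ({ξ} : Set (IwasawaAlgebra p)) = Ideal.span {L})
    {ϖ : ℚ} (hϖ0 : ϖ ≠ 0) (hvϖ : padicValRat p ϖ = 0) :
    ∃ h : IwasawaAlgebra p, IsUnit h ∧
      iwasawaToPowerSeries p ξ = PowerSeries.C (ϖ : ℚ_[p]) * iwasawaToPowerSeries p (L * h) := by
  obtain ⟨v, hv⟩ := (Ideal.span_singleton_eq_span_singleton.mp hspan)
  obtain ⟨u, hu⟩ := exists_units_coe_eq_ratCast hϖ0 hvϖ
  obtain ⟨-, hιu⟩ := span_C_units_mul_eq u (L * (↑(v⁻¹) * PowerSeries.C ((u⁻¹ : ℤ_[p]ˣ) : ℤ_[p])))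
  refine ⟨↑(v⁻¹) * PowerSeries.C ((u⁻¹ : ℤ_[p]ˣ) : ℤ_[p]), ?_, ?_⟩
  · exact (Units.isUnit v⁻¹).mul ((Units.isUnit u⁻¹).map PowerSeries.C)
  · rw [← hu, ← hιu]
    congr 1
    rw [← hv]
    have hC : PowerSeries.C ((u : ℤ_[p]ˣ) : ℤ_[p]) * PowerSeries.C ((u⁻¹ : ℤ_[p]ˣ) : ℤ_[p]) = 1 := by
      rw [← map_mul, Units.mul_inv, map_one]
    calc ξ = ξ * ((v : IwasawaAlgebra p) * ↑(v⁻¹)) *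
          (PowerSeries.C ((u : ℤ_[p]ˣ) : ℤ_[p]) * PowerSeries.C ((u⁻¹ : ℤ_[p]ˣ) : ℤ_[p])) := by
            rw [Units.mul_inv, hC, mul_one, mul_one]
      _ = PowerSeries.C ((u : ℤ_[p]ˣ) : ℤ_[p]) *
            (ξ * v * (↑(v⁻¹) * PowerSeries.C ((u⁻¹ : ℤ_[p]ˣ) : ℤ_[p]))) := by ring

/-- **The registered stub (B) `stub_chromaticDivisibility` of crux `SprungLowerHalfAtThree` (header
VERBATIM) for CM-PARTNERED X8 pairs, MODULO the OPEN binder — at EVERY analytic rank, NO (conv₀)/(low₀)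
input.** Extra leading binders: the transfer (`hCL`, PRE), Pollack–Rubin (`hPR`), the period-unit facts
(`h5`, `h3`), and per curve the partner data `hpartner`. Proof: on X8 some colour has `L^• ≠ 0`
(Rohrlich, `ClassX8.exists_chromaticL_ne_zero`); the transfer gives `ξ` with (K•) and `(ξ) = (L^•)`; the
period ratio `ϖ` is a `3`-adic unit (`h3`, `E[3]` irreducible on X8), so `ι ξ = ϖ·ι(L^•·h)` with `h` a
unit. CONDITIONAL; closes nothing. [claim: CorpuzLei2025, status: under-review]
[cite: Sprung2012, Main Conj. 7.21 and Prop. 6.14] [cite: PollackRubin2004, Theorem (p. 448) = Thm. 7.3]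
[cite: GreenbergVatsal2000, §3 Remark 3.4] -/
theorem X8.stub_chromaticDivisibility_of_cmPartner_of_transfer_OPEN
    (hCL : CorpuzLei2025_sharpFlatMainConjecture_transfer_OPEN)
    (hPR : PollackRubin2004.mainTheorem_signedCharIdeal_eq_of_cm)
    (h5 : realPeriodRat_eq_unit_mul_plusPeriod) (h3 : realPeriodRat_eq_unit_mul_plusPeriod_three) :
    ∀ (W : WeierstrassCurve ℚ) [W.IsElliptic] [W.IsGloballyMinimal] (p : ℕ) [Fact p.Prime],
      Literature.NumberTheory.EllipticCurves.Rank1Residual.ClassX8 W p →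
      (∃ (W' : WeierstrassCurve ℚ) (_ : W'.IsElliptic) (_ : W'.IsGloballyMinimal),
        W'.HasCM ∧ Literature.NumberTheory.EllipticCurves.Rank1Residual.GoodSS W' p ∧
        W'.frobeniusTrace p = 0 ∧
        (∃ e : geomTorsion W (p : ℤ) ≃+ geomTorsion W' (p : ℤ),
          ∀ (σ : Field.absoluteGaloisGroup ℚ) (P : geomTorsion W (p : ℤ)), e (σ • P) = σ • e P) ∧
        Summit.BirchSwinnertonDyer.Rank1Residual.Supersingular.SignedMuVanishing W' p) →
      ∀ (N : ℕ) (_ : NeZero N) (f : CuspForm (CongruenceSubgroup.Gamma0 N) 2) (ϖ : ℚ)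
        (Lsharp Lflat : Literature.NumberTheory.EllipticCurves.IwasawaAlgebra p),
        Literature.NumberTheory.EllipticCurves.ModularForms.IsNewformOf W f →
        (ϖ : ℝ) * W.realPeriodRat = Literature.NumberTheory.EllipticCurves.ModularForms.plusPeriod f →
        Literature.NumberTheory.EllipticCurves.Sprung2017.IsSprungPair f p (W.frobeniusTrace p)
          Lsharp Lflat →
        ∃ (c : Literature.NumberTheory.EllipticCurves.Sprung2017.Chroma)
          (ξ : Literature.NumberTheory.EllipticCurves.IwasawaAlgebra p),
          (⟨ξ, 0, 0⟩ : Summit.BirchSwinnertonDyer.Rank1Residual.Supersingular.SignedDatum W p).EulerCharacteristic ∧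
          ∃ h : Literature.NumberTheory.EllipticCurves.IwasawaAlgebra p,
            Literature.NumberTheory.EllipticCurves.iwasawaToPowerSeries p ξ =
              PowerSeries.C (ϖ : ℚ_[p]) *
                Literature.NumberTheory.EllipticCurves.iwasawaToPowerSeries p
                  (Literature.NumberTheory.EllipticCurves.Sprung2017.chromaticL c Lsharp Lflat * h) := by
  intro W _ _ p _ hX hpartner N hN f ϖ Lsharp Lflat hf hϖ hSP
  obtain ⟨W', _, _, hcm', hss', hap', hiso, hμ⟩ := hpartner
  have hp3 : p = 3 := hX.1
  subst hp3
  have hgood : W.HasGoodReductionAtPrime 3 := hX.2.1.1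
  have hirr : W.HasIrreducibleModPGaloisRep 3 := ClassX8.irr W 3 hX
  -- a colour with `L^• ≠ 0` (Rohrlich)
  obtain ⟨c, hc⟩ := ClassX8.exists_chromaticL_ne_zero W 3 hX hf hSP
  obtain ⟨ξ, hK, hspan⟩ := sharpFlatMainConjecture_of_cmPartner_of_transfer_OPEN W W' 3 hCL hPR h5 h3
    (by decide) hgood hX.2.1.2 hcm' hss' hap' hiso hμ hf hSP c hc
  -- the period ratio is a `3`-adic unit
  have hvϖ : padicValRat 3 ϖ = 0 :=
    padicValRat_periodRatio_eq_zero h5 h3 W 3 (by decide) hgood hirr f hf ϖ hϖ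
  have hϖ0 : ϖ ≠ 0 := by
    intro hz
    rw [hz, Rat.cast_zero, zero_mul] at hϖ
    exact (IsNewform0.plusPeriod_pos_holds hf.1 hf.coeffField_eq_bot).ne' hϖ.symm
  obtain ⟨h, -, hh⟩ := exists_isUnit_eq_C_mul_of_span_eq 3 hspan hϖ0 hvϖ
  exact ⟨c, ξ, hK, h, hh⟩

/-- **X8 ∧ {r_an = 0} with a CM partner: `BSD(E,3)` MODULO the OPEN binder** — on the small-image
(3Nn) X8 cells the FIRST road at all (`X8_smallImage_no_engine`: no Kato (12.5.2), no Wuthrich Prop. 21,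
no FW/CCSS locus). Chain: modularity (`hmodE`) gives the newform `f`; `thm112_exists_isSprungPair_holds`
(PROVED) a Sprung pair; in rank `0` both colours are non-zero; the transfer gives `ξ` with (K♭) and
`(ξ) = (L♭)`; then `bsdp_iff_span_eq_span_chromaticL_of_analyticRank_eq_zero` (EQUALITY ⟹ `BSDp`; GZK
`hGZK`, `hmod`, period unit `h3`; its displayed Kato divisibility is read off the equality). CONDITIONAL
on `hCL`; per pair it needs a congruence certificate (Fisher's Hesse pencils) and the partner's `μ`-node.
[claim: CorpuzLei2025, status: under-review] [cite: Sprung2012, Main Conj. 7.21 (p. 1505)]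
[cite: Sprung2017, Thm. 1.12 and Cor. 4.11] [cite: Sprung2024, Lemmas 5.5–5.9 (pp. 40–41)]
[cite: PollackRubin2004, Theorem (p. 448) = Thm. 7.3] [cite: Miller2011LMS, Def. 1.1] -/
theorem X8.bsdp_of_cmPartner_of_transfer_OPEN_of_analyticRank_eq_zero
    (hCL : CorpuzLei2025_sharpFlatMainConjecture_transfer_OPEN)
    (hPR : PollackRubin2004.mainTheorem_signedCharIdeal_eq_of_cm)
    (h5 : realPeriodRat_eq_unit_mul_plusPeriod) (h3 : realPeriodRat_eq_unit_mul_plusPeriod_three)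
    (hmodE : exists_isNewformOf) (hmod : hasEntireLFunction_rat)
    (hGZK : rank_eq_analyticRank_of_analyticRank_le_one)
    (hX : ClassX8 W p) (h0 : W.analyticRank = 0)
    (hcm' : W'.HasCM) (hss' : GoodSS W' p) (hap' : W'.frobeniusTrace p = 0)
    (hiso : ∃ e : geomTorsion W (p : ℤ) ≃+ geomTorsion W' (p : ℤ),
      ∀ (σ : Field.absoluteGaloisGroup ℚ) (P : geomTorsion W (p : ℤ)), e (σ • P) = σ • e P)
    (hμ : SignedMuVanishing W' p) : BSDp W p := by
  have hp3 : p = 3 := hX.1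
  subst hp3
  have hgood : W.HasGoodReductionAtPrime 3 := hX.2.1.1
  have hirr : W.HasIrreducibleModPGaloisRep 3 := ClassX8.irr W 3 hX
  have hL : W.entireLFunction 1 ≠ 0 := (W.analyticRank_eq_zero_iff_holds (hmod W)).1 h0
  haveI hN : NeZero (W.conductorNorm ℤ) := ⟨(W.conductorNorm_pos_holds).ne'⟩
  obtain ⟨f, hf⟩ := hmodE W
  obtain ⟨Lsharp, Lflat, hSP⟩ :=
    thm112_exists_isSprungPair_holds (W := W) (f := f) (p := 3) (by decide) hf hgood hX.2.1.2
  have hc : chromaticL .flat Lsharp Lflat ≠ 0 := by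
    rw [chromaticL_flat]
    exact (ClassX8.sharp_ne_zero_and_flat_ne_zero_of_analyticRank_eq_zero W 3 hX hf hSP h0).2
  obtain ⟨ξ, hK, hspan⟩ := sharpFlatMainConjecture_of_cmPartner_of_transfer_OPEN W W' 3 hCL hPR h5 h3
    (by decide) hgood hX.2.1.2 hcm' hss' hap' hiso hμ hf hSP .flat hc
  have hU : ξ ∣ chromaticL .flat Lsharp Lflat := by
    obtain ⟨v, hv⟩ := Ideal.span_singleton_eq_span_singleton.mp hspan
    exact ⟨v, hv.symm⟩
  exact (bsdp_iff_span_eq_span_chromaticL_of_analyticRank_eq_zero W 3 hGZK (by decide) hgood hirr hL hf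
    (h3 W hgood hirr f hf) hSP .flat (ClassX8.not_dvd_chromaticConst' W 3 hX .flat) ξ hK hU).mpr hspan

/-- **The same in the typed currency of the X8 class file**: `X8.MissingInputAt W 3` for a CM-partnered
X8 pair of analytic rank `0` (its image branch is immaterial: `BSDp` gives both `MissingLowerBoundAt` and
`MissingPPartAt`, with `Ш` finite by GZK). CONDITIONAL on `hCL`. [claim: CorpuzLei2025, status: under-review]
[cite: Sprung2012, Main Conj. 7.21 (p. 1505)] [cite: Miller2011LMS, Def. 1.1] -/
theorem X8.missingInputAt_of_cmPartner_of_transfer_OPEN_of_analyticRank_eq_zero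
    (hCL : CorpuzLei2025_sharpFlatMainConjecture_transfer_OPEN)
    (hPR : PollackRubin2004.mainTheorem_signedCharIdeal_eq_of_cm)
    (h5 : realPeriodRat_eq_unit_mul_plusPeriod) (h3 : realPeriodRat_eq_unit_mul_plusPeriod_three)
    (hmodE : exists_isNewformOf) (hmod : hasEntireLFunction_rat)
    (hGZK : rank_eq_analyticRank_of_analyticRank_le_one)
    (hX : ClassX8 W p) (h0 : W.analyticRank = 0)
    (hcm' : W'.HasCM) (hss' : GoodSS W' p) (hap' : W'.frobeniusTrace p = 0)
    (hiso : ∃ e : geomTorsion W (p : ℤ) ≃+ geomTorsion W' (p : ℤ),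
      ∀ (σ : Field.absoluteGaloisGroup ℚ) (P : geomTorsion W (p : ℤ)), e (σ • P) = σ • e P)
    (hμ : SignedMuVanishing W' p) : X8.MissingInputAt W p := by
  have hB : BSDp W p := X8.bsdp_of_cmPartner_of_transfer_OPEN_of_analyticRank_eq_zero W W' p hCL hPR h5
    h3 hmodE hmod hGZK hX h0 hcm' hss' hap' hiso hμ
  haveI : Finite W.sha := (hGZK W (by omega)).2
  have hPP : MissingPPartAt W p := missingPPartAt_of_bsdp W p hB
  exact ⟨fun _ _ ↦ (lower_and_upper_of_missingPPartAt W p hPP).1, fun _ ↦ hPP⟩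

end Consumers

end Summit.BirchSwinnertonDyer.BirchSwinnertonDyer.Theorems

end
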